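import Summits.KontsevichZagierPeriods.Zeta5Search.LaiSweepShard

/-!
# `κ₃` sweep certificate — shard file 050 of 127 (shards 350–356 of 889)

HONEST FRAMING. Systematic search; no irrationality claim unless certified. This file only checks,
by `decide +kernel`, shards 350–356 of the order-cell sweep of the `κ₃` point `(74, 2180, 444; δ74)`
(engine `LaiSweepEngine`, soundness `LaiSweepJump/Free/Eval/Shard/Kappa3`; a shard is `⟨regime, n,
p, q, p', q', Lo, Up⟩`: `n` cells from `p/q` to `p'/q'` with integer rate sums in `[Lo, Up]`, `K =
128`, `D = 2^40`). It draws NO conclusion: only the capstone `LaiKappa3SweepCert`, which needs all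
127 shard files, does. Kernel cost of this file ≈ 560 cells × 0.3 s.
-/

namespace Summit.KontsevichZagierPeriods.Zeta5Search.Sweep

set_option maxHeartbeats 100000000 in
/-- Shard 350: 80 cells of regime B from `97/301` to `142/439`.
[cite: Lai2024BallRivoal, §4 Lemma 4.3] -/
theorem shard350 :
    Shard.check 128 (2^40)
      ⟨true, 80, 97, 301, 142, 439, 20336234845772, 22049881944291⟩ = true := by
  decide +kernel

set_option maxHeartbeats 100000000 in
/-- Shard 351: 80 cells of regime B from `142/439` to `139/428`.
[cite: Lai2024BallRivoal, §4 Lemma 4.3] -/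
theorem shard351 :
    Shard.check 128 (2^40)
      ⟨true, 80, 142, 439, 139, 428, 21967466726727, 23834841203605⟩ = true := by
  decide +kernel

set_option maxHeartbeats 100000000 in
/-- Shard 352: 80 cells of regime B from `139/428` to `104/319`.
[cite: Lai2024BallRivoal, §4 Lemma 4.3] -/
theorem shard352 :
    Shard.check 128 (2^40)
      ⟨true, 80, 139, 428, 104, 319, 21019294531557, 22821684319323⟩ = true := by
  decide +kernel

set_option maxHeartbeats 100000000 in
/-- Shard 353: 80 cells of regime B from `104/319` to `393/1201`.
[cite: Lai2024BallRivoal, §4 Lemma 4.3] -/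
theorem shard353 :
    Shard.check 128 (2^40)
      ⟨true, 80, 104, 319, 393, 1201, 20211221514407, 21959012955668⟩ = true := by
  decide +kernel

set_option maxHeartbeats 100000000 in
/-- Shard 354: 80 cells of regime B from `393/1201` to `68/207`.
[cite: Lai2024BallRivoal, §4 Lemma 4.3] -/
theorem shard354 :
    Shard.check 128 (2^40)
      ⟨true, 80, 393, 1201, 68, 207, 21287321570990, 23143806106174⟩ = true := by
  decide +kernel

set_option maxHeartbeats 100000000 in
/-- Shard 355: 80 cells of regime B from `68/207` to `396/1201`.
[cite: Lai2024BallRivoal, §4 Lemma 4.3] -/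
theorem shard355 :
    Shard.check 128 (2^40)
      ⟨true, 80, 68, 207, 396, 1201, 20315157454143, 22101834173621⟩ = true := by
  decide +kernel

set_option maxHeartbeats 100000000 in
/-- Shard 356: 80 cells of regime B from `396/1201` to `46/139`.
[cite: Lai2024BallRivoal, §4 Lemma 4.3] -/
theorem shard356 :
    Shard.check 128 (2^40)
      ⟨true, 80, 396, 1201, 46, 139, 20055825614763, 21834168093867⟩ = true := by
  decide +kernel

/-- The checked shards of this file, in order. [folklore] -/
def shards050 : List (CheckedShard 128 (2^40)) :=
  [⟨_, shard350⟩, ⟨_, shard351⟩, ⟨_, shard352⟩, ⟨_, shard353⟩, ⟨_, shard354⟩,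
    ⟨_, shard355⟩, ⟨_, shard356⟩]

end Summit.KontsevichZagierPeriods.Zeta5Search.Sweep
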